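import Summits.Ventures.YMGap.RobustBall.BoundaryDecayKR
import HarnessLib

/-!
# Venture YMGap, track ROBUST-BALL — ONE STATE AT A RATE, step 5: FINITE-SIZE EFFECT OF THE TORUS — the periodic
# (torus) Wilson states approach the infinite-volume state exponentially fast in the torus side

HONEST FRAMING. WHAT THIS IS: a venture file (cell `pub-ymgap`, track Y2 ROBUST-BALL, seat ds-3, theorems only): the
torus reading of the boundary-insensitivity theorems. On the torus `(ℤ/L)^d` the Wilson state satisfies the `ℤ^d` DLR
equation in every box that does not wrap around (tree `wilsonExpectation_toTorusObservable_eq`, Georgii (4.18) for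
periodic boundary conditions), so the torus expectation of a lifted local observable is an AVERAGE of finite-volume
Gibbs expectations `γ_{box n}(F | η)` over boundary fields `η` drawn from the torus state; each of them is within the
boundary bound of every DLR state (`BoundaryDecayBox.lean`, `BoundaryDecayKR.lean`). Hence:
* `abs_wilsonExpectation_sub_le_of_forall_boundary` (any compact group, any continuous representation, any `d`): a
  bound `|∫ F dγ_Λ(·|η) − c| ≤ B` valid for EVERY boundary field `η` is inherited by the torus state,
  `|⟨F ∘ torusLift⟩_{L,β} − c| ≤ B`, as soon as `mod L` is injective on the base points of `Λ`, of the support of `F`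
  and of the plaquette collar of `Λ`;
* `image_fst_boxCollar_subset`: for `Λ = boxLinks d n` and `supp F ⊆ boxLinks d m`, `m ≤ n`, those base points lie in
  `siteBox d (n+1)`, on which `mod L` is injective once `2(n+1) < L` (`injOn_proj_siteBox`);
* ★ `su2_wilson_torus_upTo_oneNinth`: for `0 ≤ β_W ≤ 1/9`, every DLR state `μ` of `SU(2)` lattice Yang–Mills on `ℤ⁴`,
  every torus side `L > 2(n+1)` and every Lipschitz cylinder `F` (constant `K`) on the links based in `[−m, m]⁴`, `m ≤ n`:
  `|⟨F ∘ torusLift⟩_{(ℤ/L)⁴, β_W} − ∫ F dμ| ≤ 2√2 · K · #Δ · 2^{−(n−m)}` — THE FINITE-SIZE EFFECT OF THE TORUS IS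
  EXPONENTIALLY SMALL IN ITS SIDE (rate `log 2 / 2` per unit of `L` at fixed `m`); `1/9 ≤ β_W < 2/9`:
  `((9/2)β_W)^{n−m}` (`su2_wilson_torus_lt_twoNinths`); the quantitative form of the cell's full-sequence torus limit
  (`OneStateLimit.lean`, `StrongCouplingPhaseAt`), uniform in the DLR state and with explicit constants.
* every `N ≥ 2`, `d = 4`, 't Hooft `|β| < 1/48`, hypothesis-free (Bakry–Émery zero member, `ρ = 18|β|/(1/2 − 6|β|)`):
  `suN_wilson_boundary_dim4`, `suN_wilson_box_dim4`, ★ `suN_wilson_torus_dim4` (`≤ 2√N · K · #Δ · max(ρ,½)^{n−m}`);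
  every `N ≥ 2`, EVERY `d ≥ 1`, `2(d−1)|β| < 1/2`: `suN_wilson_boundary_bakryEmery`, `suN_wilson_box_bakryEmery`,
  ★ `suN_wilson_torus_bakryEmery` (`ρ ≥ 6(d−1)|β|/(1/2 − 2(d−1)|β|)`; `ℤ³`: `|β| < 1/32`).
WHAT THIS IS NOT: Dobrushin-comparison lower bound on the rate inside the single-link doors (`SU(2)`: `β_W < 2/9`); says
nothing at the couplings of the Y3 FLOW-DATA crossover tables beyond that window; lattice strong coupling only, nothing
about the continuum limit or the Clay Millennium problem.

References: H.-O. Georgii (2011), Thm. 4.17 / (4.18), Remark 8.26; S. Friedli, Y. Velenik (2017), remark before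
Ex. 6.14 (periodic b.c.); E. Seiler, LNP 159 (1982), Ch. 2; the tree's `LatticeGaugeDLRGibbsProofs.lean`
(`wilsonExpectation_toTorusObservable_eq`), the track's `BoundaryDecayBox.lean`, `BoundaryDecayKR.lean`, `PeriodisedBox.lean`.
-/

noncomputable section

open MeasureTheory Filter Function ProbabilityTheory Real
open scoped NNReal
open Literature.Probability.LatticeModels
open Literature.Probability.LatticeModels.DobrushinMetric
open Literature.MathematicalPhysics.QuantumLattice
open Literature.MathematicalPhysics.QuantumFieldTheory hiding ZdEdge Site

namespace Summit.Ventures.YMGap.RobustBall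

variable {d N : ℕ}

/-! ### The torus state inherits every bound that is uniform in the boundary field -/

section Torus

variable {G : Type*} [Group G] [TopologicalSpace G] [IsTopologicalGroup G] [CompactSpace G] [MeasurableSpace G]
  [BorelSpace G] [SecondCountableTopology G]

/-- **The torus Wilson state inherits every boundary-uniform bound.** Let `ρ` be a continuous representation, `F` a
bounded continuous cylinder observable on `ℤ^d` with support `S₀`, `Λ` a finite link volume, and `L` so large that
`mod L` is injective on the base points of `Λ ∪ S₀ ∪ ∂Λ`. If `|∫ F dγ_Λ(· | η) − c| ≤ B` for EVERY boundary field `η`,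
then `|⟨F ∘ torusLift⟩_{(ℤ/L)^d, β} − c| ≤ B`: by the torus DLR identity (`wilsonExpectation_toTorusObservable_eq`) the
torus expectation of `F ∘ torusLift` is the torus average of `η ↦ ∫ F dγ_Λ(· | η)` over lifted torus fields. [folklore] -/
theorem abs_wilsonExpectation_sub_le_of_forall_boundary (ρ : G →* Matrix (Fin N) (Fin N) ℂ) (hρ : Continuous ρ)
    (β : ℝ) (Λ : Finset (ZdEdge d)) {F : LGConfig d G → ℝ} (hF : Continuous F) {C : ℝ} (hC : ∀ U, |F U| ≤ C)
    {S₀ : Finset (ZdEdge d)} (hFS : IsCylinder F S₀) {L : ℕ} [NeZero L]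
    (hL : Set.InjOn (Torus.proj L)
      ((Λ ∪ S₀ ∪ (plaquettesTouching Λ).biUnion plaquetteEdges).image Prod.fst : Set (Site d)))
    {c B : ℝ} (hB : ∀ η, |(∫ U, F U ∂(ymSpecification ρ β Λ η)) - c| ≤ B) :
    |wilsonExpectation ρ β (toTorusObservable L F) - c| ≤ B := by
  haveI := isProbabilityMeasure_wilsonMeasure (d := d) (L := L) ρ hρ β
  rw [wilsonExpectation_toTorusObservable_eq ρ hρ β Λ hF hC hFS hL]
  set g : LGConfig d G → ℝ := fun η => ∫ U, F U ∂(ymSpecification ρ β Λ η) with hg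
  have hgc : Continuous g := continuous_integral_ymSpecification ρ hρ β Λ hF hC
  have hgb : ∀ η, |g η| ≤ C := abs_integral_ymSpecification_le ρ hρ β Λ hC
  have htc : Continuous (toTorusObservable L g) := hgc.comp (continuous_torusLift L)
  have hint : Integrable (toTorusObservable L g) (wilsonMeasure ρ β) :=
    Integrable.of_bound htc.measurable.aestronglyMeasurable C
      (ae_of_all _ fun V => by rw [Real.norm_eq_abs]; exact hgb _)
  unfold wilsonExpectation
  have e1 : (∫ V, toTorusObservable L g V ∂(wilsonMeasure ρ β)) - c =
      ∫ V, (toTorusObservable L g V - c) ∂(wilsonMeasure ρ β) := by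
    rw [integral_sub hint (integrable_const c), integral_const, smul_eq_mul, probReal_univ, one_mul]
  rw [e1]
  calc |∫ V, (toTorusObservable L g V - c) ∂(wilsonMeasure ρ β)|
      ≤ ∫ V, |toTorusObservable L g V - c| ∂(wilsonMeasure ρ β) := abs_integral_le_integral_abs
    _ ≤ ∫ _V, B ∂(wilsonMeasure ρ β) :=
        integral_mono (hint.sub (integrable_const c)).abs (integrable_const B) fun V => hB _
    _ = B := by simp

end Torus

/-! ### Geometry: the collar of a box of links, and continuity of Lipschitz cylinders -/

/-- **The base points of a box of links, of an observable inside it and of its plaquette collar lie one layer out**: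
for `Δ ⊆ boxLinks d m`, `m ≤ n`, the base points of `boxLinks d n ∪ Δ ∪ ∂(boxLinks d n)` lie in `siteBox d (n + 1)`
(two links of one plaquette have base points at `ℓ^∞`-distance `≤ 1`). [folklore] -/
theorem image_fst_boxCollar_subset {m n : ℕ} (hmn : m ≤ n) {Δ : Finset (ZdEdge d)} (hΔ : Δ ⊆ boxLinks d m) :
    (boxLinks d n ∪ Δ ∪ (plaquettesTouching (boxLinks d n)).biUnion plaquetteEdges).image Prod.fst ⊆
      siteBox d (n + 1) := by
  classical
  intro x hx
  obtain ⟨e, he, rfl⟩ := Finset.mem_image.1 hx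
  rw [mem_siteBox_iff_norm, Nat.cast_add, Nat.cast_one]
  rcases Finset.mem_union.1 he with he | he
  · rcases Finset.mem_union.1 he with he | he
    · have h := (mem_siteBox_iff_norm.1 (mem_boxLinks.1 he))
      linarith
    · have h := (mem_siteBox_iff_norm.1 (mem_boxLinks.1 (hΔ he)))
      have hmn' : (m : ℝ) ≤ n := by exact_mod_cast hmn
      linarith
  · obtain ⟨p, hp, hep⟩ := Finset.mem_biUnion.1 he
    obtain ⟨z, hz⟩ := mem_plaquettesTouching_iff.1 hp
    obtain ⟨hzp, hzbox⟩ := Finset.mem_inter.1 hz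
    have h1 : ‖z.1 - e.1‖ ≤ 1 := norm_sub_le_one_of_mem_plaquetteEdges hzp hep
    have h2 := mem_siteBox_iff_norm.1 (mem_boxLinks.1 hzbox)
    have h3 : ‖e.1‖ ≤ ‖z.1‖ + ‖z.1 - e.1‖ := by
      have := norm_sub_norm_le e.1 z.1
      rw [norm_sub_rev] at this
      linarith
    linarith

/-- A Lipschitz cylinder of the fundamental representation is continuous. [folklore] -/
theorem continuous_of_isLipschitzCylinder {F : LGConfig d (Matrix.specialUnitaryGroup (Fin N) ℂ) → ℝ}
    {Δ : Finset (ZdEdge d)} {K : ℝ≥0} (hF : IsLipschitzCylinder (fundamentalRep (Fin N)) F Δ K) : Continuous F := by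
  obtain ⟨f, hf, hFf⟩ := hF
  have e : F = f ∘ fun U (e : ↥Δ) (i j : Fin N) => (fundamentalRep (Fin N)) (U e) i j := funext hFf
  rw [e]
  refine hf.continuous.comp (continuous_pi fun e => continuous_pi fun i => continuous_pi fun j => ?_)
  have he : Continuous fun U : LGConfig d (Matrix.specialUnitaryGroup (Fin N) ℂ) => U (e : ZdEdge d) :=
    continuous_apply _
  exact ((continuous_fundamentalRep (Fin N)).comp he).matrix_elem i j

/-! ### `SU(2)` on `ℤ⁴`: the finite-size effect of the torus -/

/-- ★ **FINITE-SIZE EFFECT OF THE TORUS, `SU(2)`, `d = 4`, `0 ≤ β_W ≤ 1/9`.** For every DLR state `μ` of `SU(2)` lattice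
Yang–Mills on `ℤ⁴` (tree coupling `β_W/2`), every torus side `L` with `2(n+1) < L`, every `m ≤ n` and every Lipschitz
cylinder `F` (constant `K`) on links `Δ` based in `[−m, m]⁴`:
`|⟨F ∘ torusLift⟩_{(ℤ/L)⁴, β_W} − ∫ F dμ| ≤ 2√2 · K · #Δ · (1/2)^{n − m}` — the torus Wilson state is exponentially close,
in the free room `n − m ≈ L/2 − m`, to the (unique) infinite-volume state. [folklore] -/
theorem su2_wilson_torus_upTo_oneNinth {βW : ℝ} (h0 : 0 ≤ βW) (h : βW ≤ 1 / 9)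
    {μ : Measure (LGConfig 4 (Matrix.specialUnitaryGroup (Fin 2) ℂ))}
    (hμ : μ ∈ ymGibbsMeasures (d := 4) (fundamentalRep (Fin 2)) (βW / 2)) {m n L : ℕ} [NeZero L] (hmn : m ≤ n)
    (hL : 2 * (n + 1) < L) {F : LGConfig 4 (Matrix.specialUnitaryGroup (Fin 2) ℂ) → ℝ} {Δ : Finset (ZdEdge 4)} {K : ℝ≥0}
    (hF : IsLipschitzCylinder (fundamentalRep (Fin 2)) F Δ K) (hΔ : Δ ⊆ boxLinks 4 m) :
    |wilsonExpectation (fundamentalRep (Fin 2)) (βW / 2) (toTorusObservable L F) - ∫ U, F U ∂μ| ≤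
      2 * Real.sqrt 2 * K * Δ.card * (1 / 2 : ℝ) ^ (n - m) :=
  abs_wilsonExpectation_sub_le_of_forall_boundary (fundamentalRep (Fin 2)) (continuous_fundamentalRep (Fin 2)) (βW / 2)
    (boxLinks 4 n) (continuous_of_isLipschitzCylinder hF) hF.abs_le hF.isCylinder
    ((injOn_proj_siteBox hL).mono (Finset.coe_subset.2 (image_fst_boxCollar_subset hmn hΔ)))
    fun η => su2_wilson_box_upTo_oneNinth h0 h hμ n η hF hΔ

/-- **FINITE-SIZE EFFECT OF THE TORUS, `SU(2)`, `d = 4`, `1/9 ≤ β_W < 2/9`**: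
`|⟨F ∘ torusLift⟩_{(ℤ/L)⁴, β_W} − ∫ F dμ| ≤ 2√2 · K · #Δ · ((9/2)β_W)^{n − m}` for `2(n+1) < L`, `m ≤ n`. [folklore] -/
theorem su2_wilson_torus_lt_twoNinths {βW : ℝ} (h0 : 1 / 9 ≤ βW) (h : βW < 2 / 9)
    {μ : Measure (LGConfig 4 (Matrix.specialUnitaryGroup (Fin 2) ℂ))}
    (hμ : μ ∈ ymGibbsMeasures (d := 4) (fundamentalRep (Fin 2)) (βW / 2)) {m n L : ℕ} [NeZero L] (hmn : m ≤ n)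
    (hL : 2 * (n + 1) < L) {F : LGConfig 4 (Matrix.specialUnitaryGroup (Fin 2) ℂ) → ℝ} {Δ : Finset (ZdEdge 4)} {K : ℝ≥0}
    (hF : IsLipschitzCylinder (fundamentalRep (Fin 2)) F Δ K) (hΔ : Δ ⊆ boxLinks 4 m) :
    |wilsonExpectation (fundamentalRep (Fin 2)) (βW / 2) (toTorusObservable L F) - ∫ U, F U ∂μ| ≤
      2 * Real.sqrt 2 * K * Δ.card * (9 / 2 * βW) ^ (n - m) :=
  abs_wilsonExpectation_sub_le_of_forall_boundary (fundamentalRep (Fin 2)) (continuous_fundamentalRep (Fin 2)) (βW / 2)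
    (boxLinks 4 n) (continuous_of_isLipschitzCylinder hF) hF.abs_le hF.isCylinder
    ((injOn_proj_siteBox hL).mono (Finset.coe_subset.2 (image_fst_boxCollar_subset hmn hΔ)))
    fun η => su2_wilson_box_lt_twoNinths h0 h hμ n η hF hΔ

/-- **The torus side reading, `0 ≤ β_W ≤ 1/9`**: on the torus `(ℤ/(2n+3))⁴` a Lipschitz cylinder based in `[−m, m]⁴`,
`m ≤ n`, has expectation within `2√2 · K · #Δ · 2^{−(n−m)}` of its infinite-volume expectation in every DLR state.
[folklore] -/
theorem su2_wilson_torus_side_upTo_oneNinth {βW : ℝ} (h0 : 0 ≤ βW) (h : βW ≤ 1 / 9)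
    {μ : Measure (LGConfig 4 (Matrix.specialUnitaryGroup (Fin 2) ℂ))}
    (hμ : μ ∈ ymGibbsMeasures (d := 4) (fundamentalRep (Fin 2)) (βW / 2)) {m : ℕ} (n : ℕ) (hmn : m ≤ n)
    {F : LGConfig 4 (Matrix.specialUnitaryGroup (Fin 2) ℂ) → ℝ} {Δ : Finset (ZdEdge 4)} {K : ℝ≥0}
    (hF : IsLipschitzCylinder (fundamentalRep (Fin 2)) F Δ K) (hΔ : Δ ⊆ boxLinks 4 m) :
    |wilsonExpectation (fundamentalRep (Fin 2)) (βW / 2) (toTorusObservable (2 * n + 3) F) - ∫ U, F U ∂μ| ≤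
      2 * Real.sqrt 2 * K * Δ.card * (1 / 2 : ℝ) ^ (n - m) :=
  haveI : NeZero (2 * n + 3) := ⟨by omega⟩
  su2_wilson_torus_upTo_oneNinth h0 h hμ hmn (by omega) hF hΔ

/-- **TWO-SIDED finite-size effect of the torus, `SU(2)`, `d = 4`, `|β_W| ≤ 1/9`**: `|⟨F ∘ torusLift⟩_{(ℤ/L)⁴, β_W} − ∫ F dμ| ≤
2√2 · K · #Δ · (1/2)^{n − m}` for `2(n+1) < L`, `m ≤ n` (`su2_wilson_box_abs_le_oneNinth`). [folklore] -/
theorem su2_wilson_torus_abs_le_oneNinth {βW : ℝ} (h : |βW| ≤ 1 / 9)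
    {μ : Measure (LGConfig 4 (Matrix.specialUnitaryGroup (Fin 2) ℂ))}
    (hμ : μ ∈ ymGibbsMeasures (d := 4) (fundamentalRep (Fin 2)) (βW / 2)) {m n L : ℕ} [NeZero L] (hmn : m ≤ n)
    (hL : 2 * (n + 1) < L) {F : LGConfig 4 (Matrix.specialUnitaryGroup (Fin 2) ℂ) → ℝ} {Δ : Finset (ZdEdge 4)} {K : ℝ≥0}
    (hF : IsLipschitzCylinder (fundamentalRep (Fin 2)) F Δ K) (hΔ : Δ ⊆ boxLinks 4 m) :
    |wilsonExpectation (fundamentalRep (Fin 2)) (βW / 2) (toTorusObservable L F) - ∫ U, F U ∂μ| ≤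
      2 * Real.sqrt 2 * K * Δ.card * (1 / 2 : ℝ) ^ (n - m) :=
  abs_wilsonExpectation_sub_le_of_forall_boundary (fundamentalRep (Fin 2)) (continuous_fundamentalRep (Fin 2)) (βW / 2)
    (boxLinks 4 n) (continuous_of_isLipschitzCylinder hF) hF.abs_le hF.isCylinder
    ((injOn_proj_siteBox hL).mono (Finset.coe_subset.2 (image_fst_boxCollar_subset hmn hΔ)))
    fun η => su2_wilson_box_abs_le_oneNinth h hμ n η hF hΔ

/-! ### Every `N ≥ 2` on `ℤ⁴` at 't Hooft `|β| < 1/48`: boundary, boxes, torus (Bakry–Émery, hypothesis-free) -/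

/-- **EVERY `N ≥ 2`, `d = 4`, WILSON, 't Hooft `|β| < 1/48` (tree coupling `N β`)**: with `ρ ≥ 18|β|/(1/2 − 6|β|)`, `ρ < 1`
(the Bakry–Émery zero member: `b = 6|β| < 1/2`, zero loads), every DLR state `μ` of `SU(N)` lattice Yang–Mills on `ℤ⁴`
and every finite-volume Wilson distribution with ANY boundary field satisfy
`|∫ F dγ_V(· | η) − ∫ F dμ| ≤ 2√N · K_F · #Δ · max(ρ,½)^{⌊D⌋₊}` on Lipschitz cylinders at depth `D`. [folklore] -/
theorem suN_wilson_boundary_dim4 (hN : 2 ≤ N) {β ρ : ℝ} (hβ : |β| < 1 / 48)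
    (hρ : 18 * |β| / (1 / 2 - 6 * |β|) ≤ ρ) (hρ1 : ρ < 1)
    {μ : Measure (LGConfig 4 (Matrix.specialUnitaryGroup (Fin N) ℂ))}
    (hμ : μ ∈ ymGibbsMeasures (d := 4) (fundamentalRep (Fin N)) (N * β))
    (V : Finset (ZdEdge 4)) (η : LGConfig 4 (Matrix.specialUnitaryGroup (Fin N) ℂ))
    {F : LGConfig 4 (Matrix.specialUnitaryGroup (Fin N) ℂ) → ℝ} {Δ : Finset (ZdEdge 4)} {KF : ℝ≥0}
    (hF : IsLipschitzCylinder (fundamentalRep (Fin N)) F Δ KF) {D : ℝ}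
    (hD : ∀ y ∈ Δ, ∀ z, z ∉ V → D ≤ ‖y.1 - z.1‖) :
    |(∫ U, F U ∂(ymSpecification (d := 4) (fundamentalRep (Fin N)) (N * β) V η)) - ∫ U, F U ∂μ| ≤
      2 * Real.sqrt N * KF * Δ.card * (max ρ (1 / 2)) ^ ⌊D⌋₊ := by
  classical
  set supp : Finset (ZdEdge 4) → Finset (Finset (ZdEdge 4)) := fun _ => ∅ with hsupp
  have hmem : MemBallZd (N := N) (0 : ℝ) 0 0 (0 : Potential (ZdEdge 4) (Matrix.specialUnitaryGroup (Fin N) ℂ)) supp :=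
    memBallZd_zero le_rfl le_rfl fun _ _ h => by simp [hsupp] at h
  have hμ' : μ ∈ perturbedGibbsMeasures (d := 4) (fundamentalRep (Fin N)) (N * β) 0 supp := by
    rwa [perturbedGibbsMeasures_zero]
  have h3 : (((4 : ℕ) : ℝ) - 1) = 3 := by norm_num
  have hb : |β| * (2 * (((4 : ℕ) : ℝ) - 1)) < 1 / 2 := by rw [h3]; linarith
  have hden : 0 < 1 / 2 - 6 * |β| := by linarith
  have hρ' : 6 * (((4 : ℕ) : ℝ) - 1) * |β| * exp 0 / (1 / 2 - |β| * (2 * (((4 : ℕ) : ℝ) - 1))) +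
      exp (0 / 2) * 0 / Real.sqrt ((N : ℝ) * (1 / 2 - |β| * (2 * (((4 : ℕ) : ℝ) - 1)))) ≤ ρ := by
    rw [h3, Real.exp_zero, mul_zero, zero_div, add_zero, mul_one]
    have e : 6 * (3 : ℝ) * |β| / (1 / 2 - |β| * (2 * 3)) = 18 * |β| / (1 / 2 - 6 * |β|) := by
      rw [show |β| * (2 * 3) = 6 * |β| by ring, show 6 * (3 : ℝ) * |β| = 18 * |β| by ring]
    rw [e]
    exact hρ
  have key := suN_abs_boundary_sub_integral_le_bakryEmery (d := 4) (by norm_num) hN (ε₀ := 0) (ε₁ := 0) (R := 0) hb hρ'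
    hρ1 hmem hμ' V η hF hD
  rw [perturbedYM_zero, max_eq_left (zero_le_one : (0 : ℝ) ≤ 1), div_one] at key
  exact key

/-- **EVERY `N ≥ 2`, `d = 4`, boxes**: `|∫ F dγ_{boxLinks 4 n}(· | η) − ∫ F dμ| ≤ 2√N · K_F · #Δ · max(ρ,½)^{n − m}` for Lipschitz
cylinders based in `[−m, m]⁴`, under the hypotheses of `suN_wilson_boundary_dim4`. [folklore] -/
theorem suN_wilson_box_dim4 (hN : 2 ≤ N) {β ρ : ℝ} (hβ : |β| < 1 / 48)
    (hρ : 18 * |β| / (1 / 2 - 6 * |β|) ≤ ρ) (hρ1 : ρ < 1)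
    {μ : Measure (LGConfig 4 (Matrix.specialUnitaryGroup (Fin N) ℂ))}
    (hμ : μ ∈ ymGibbsMeasures (d := 4) (fundamentalRep (Fin N)) (N * β)) {m : ℕ} (n : ℕ)
    (η : LGConfig 4 (Matrix.specialUnitaryGroup (Fin N) ℂ))
    {F : LGConfig 4 (Matrix.specialUnitaryGroup (Fin N) ℂ) → ℝ} {Δ : Finset (ZdEdge 4)} {KF : ℝ≥0}
    (hF : IsLipschitzCylinder (fundamentalRep (Fin N)) F Δ KF) (hΔ : Δ ⊆ boxLinks 4 m) :
    |(∫ U, F U ∂(ymSpecification (d := 4) (fundamentalRep (Fin N)) (N * β) (boxLinks 4 n) η)) - ∫ U, F U ∂μ| ≤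
      2 * Real.sqrt N * KF * Δ.card * (max ρ (1 / 2)) ^ (n - m) := by
  have key := suN_wilson_boundary_dim4 hN hβ hρ hρ1 hμ (boxLinks 4 n) η hF (D := (n : ℝ) - m)
    fun _ hy _ hz => sub_le_norm_sub_of_mem_boxLinks (hΔ hy) hz
  rwa [natFloor_natCast_sub_natCast] at key

/-- ★ **FINITE-SIZE EFFECT OF THE TORUS, EVERY `N ≥ 2`, `d = 4`, 't Hooft `|β| < 1/48`**: for every DLR state `μ` of `SU(N)`
lattice Yang–Mills on `ℤ⁴` (tree coupling `N β`), every torus side `L > 2(n+1)`, `m ≤ n`, and every Lipschitz cylinder `F`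
on links based in `[−m, m]⁴`: `|⟨F ∘ torusLift⟩_{(ℤ/L)⁴, Nβ} − ∫ F dμ| ≤ 2√N · K_F · #Δ · max(ρ,½)^{n − m}`,
`ρ ≥ 18|β|/(1/2 − 6|β|)`, `ρ < 1`. [folklore] -/
theorem suN_wilson_torus_dim4 (hN : 2 ≤ N) {β ρ : ℝ} (hβ : |β| < 1 / 48)
    (hρ : 18 * |β| / (1 / 2 - 6 * |β|) ≤ ρ) (hρ1 : ρ < 1)
    {μ : Measure (LGConfig 4 (Matrix.specialUnitaryGroup (Fin N) ℂ))}
    (hμ : μ ∈ ymGibbsMeasures (d := 4) (fundamentalRep (Fin N)) (N * β)) {m n L : ℕ} [NeZero L] (hmn : m ≤ n)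
    (hL : 2 * (n + 1) < L) {F : LGConfig 4 (Matrix.specialUnitaryGroup (Fin N) ℂ) → ℝ} {Δ : Finset (ZdEdge 4)}
    {KF : ℝ≥0} (hF : IsLipschitzCylinder (fundamentalRep (Fin N)) F Δ KF) (hΔ : Δ ⊆ boxLinks 4 m) :
    |wilsonExpectation (fundamentalRep (Fin N)) (N * β) (toTorusObservable L F) - ∫ U, F U ∂μ| ≤
      2 * Real.sqrt N * KF * Δ.card * (max ρ (1 / 2)) ^ (n - m) :=
  abs_wilsonExpectation_sub_le_of_forall_boundary (fundamentalRep (Fin N)) (continuous_fundamentalRep (Fin N)) (N * β)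
    (boxLinks 4 n) (continuous_of_isLipschitzCylinder hF) hF.abs_le hF.isCylinder
    ((injOn_proj_siteBox hL).mono (Finset.coe_subset.2 (image_fst_boxCollar_subset hmn hΔ)))
    fun η => suN_wilson_box_dim4 hN hβ hρ hρ1 hμ n η hF hΔ

/-! ### Every `N ≥ 2`, EVERY `d ≥ 1`: the Bakry–Émery Wilson window `|β| < 1/(16(d−1))` ('t Hooft), boundary / boxes / torus -/

/-- **EVERY `N ≥ 2`, EVERY `d ≥ 1`, WILSON** (tree coupling `N β`, Bakry–Émery zero member `b = 2(d−1)|β| < 1/2`): with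
`ρ ≥ 6(d−1)|β| / (1/2 − 2(d−1)|β|)`, `ρ < 1`, every DLR state `μ` and every finite-volume Wilson distribution with ANY boundary
field satisfy `|∫ F dγ_V(· | η) − ∫ F dμ| ≤ 2√N · K_F · #Δ · max(ρ,½)^{⌊D⌋₊}` on Lipschitz cylinders at depth `D` — in
particular on `ℤ³` for `|β| < 1/32`. [folklore] -/
theorem suN_wilson_boundary_bakryEmery (hd : 1 ≤ d) (hN : 2 ≤ N) {β ρ : ℝ} (hb : |β| * (2 * ((d : ℝ) - 1)) < 1 / 2)
    (hρ : 6 * ((d : ℝ) - 1) * |β| / (1 / 2 - |β| * (2 * ((d : ℝ) - 1))) ≤ ρ) (hρ1 : ρ < 1)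
    {μ : Measure (LGConfig d (Matrix.specialUnitaryGroup (Fin N) ℂ))}
    (hμ : μ ∈ ymGibbsMeasures (d := d) (fundamentalRep (Fin N)) (N * β))
    (V : Finset (ZdEdge d)) (η : LGConfig d (Matrix.specialUnitaryGroup (Fin N) ℂ))
    {F : LGConfig d (Matrix.specialUnitaryGroup (Fin N) ℂ) → ℝ} {Δ : Finset (ZdEdge d)} {KF : ℝ≥0}
    (hF : IsLipschitzCylinder (fundamentalRep (Fin N)) F Δ KF) {D : ℝ}
    (hD : ∀ y ∈ Δ, ∀ z, z ∉ V → D ≤ ‖y.1 - z.1‖) :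
    |(∫ U, F U ∂(ymSpecification (d := d) (fundamentalRep (Fin N)) (N * β) V η)) - ∫ U, F U ∂μ| ≤
      2 * Real.sqrt N * KF * Δ.card * (max ρ (1 / 2)) ^ ⌊D⌋₊ := by
  classical
  set supp : Finset (ZdEdge d) → Finset (Finset (ZdEdge d)) := fun _ => ∅ with hsupp
  have hmem : MemBallZd (N := N) (0 : ℝ) 0 0 (0 : Potential (ZdEdge d) (Matrix.specialUnitaryGroup (Fin N) ℂ)) supp :=
    memBallZd_zero le_rfl le_rfl fun _ _ h => by simp [hsupp] at h
  have hμ' : μ ∈ perturbedGibbsMeasures (d := d) (fundamentalRep (Fin N)) (N * β) 0 supp := by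
    rwa [perturbedGibbsMeasures_zero]
  have hρ' : 6 * ((d : ℝ) - 1) * |β| * exp 0 / (1 / 2 - |β| * (2 * ((d : ℝ) - 1))) +
      exp (0 / 2) * 0 / Real.sqrt ((N : ℝ) * (1 / 2 - |β| * (2 * ((d : ℝ) - 1)))) ≤ ρ := by
    rw [Real.exp_zero, mul_one, mul_zero, zero_div, add_zero]
    exact hρ
  have key := suN_abs_boundary_sub_integral_le_bakryEmery hd hN (ε₀ := 0) (ε₁ := 0) (R := 0) hb hρ' hρ1 hmem hμ' V η hF hD
  rw [perturbedYM_zero, max_eq_left (zero_le_one : (0 : ℝ) ≤ 1), div_one] at key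
  exact key

/-- **EVERY `N ≥ 2`, EVERY `d ≥ 1`, boxes**: `|∫ F dγ_{boxLinks d n}(· | η) − ∫ F dμ| ≤ 2√N · K_F · #Δ · max(ρ,½)^{n − m}` for
Lipschitz cylinders based in `[−m, m]^d`, under the hypotheses of `suN_wilson_boundary_bakryEmery`. [folklore] -/
theorem suN_wilson_box_bakryEmery (hd : 1 ≤ d) (hN : 2 ≤ N) {β ρ : ℝ} (hb : |β| * (2 * ((d : ℝ) - 1)) < 1 / 2)
    (hρ : 6 * ((d : ℝ) - 1) * |β| / (1 / 2 - |β| * (2 * ((d : ℝ) - 1))) ≤ ρ) (hρ1 : ρ < 1)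
    {μ : Measure (LGConfig d (Matrix.specialUnitaryGroup (Fin N) ℂ))}
    (hμ : μ ∈ ymGibbsMeasures (d := d) (fundamentalRep (Fin N)) (N * β)) {m : ℕ} (n : ℕ)
    (η : LGConfig d (Matrix.specialUnitaryGroup (Fin N) ℂ))
    {F : LGConfig d (Matrix.specialUnitaryGroup (Fin N) ℂ) → ℝ} {Δ : Finset (ZdEdge d)} {KF : ℝ≥0}
    (hF : IsLipschitzCylinder (fundamentalRep (Fin N)) F Δ KF) (hΔ : Δ ⊆ boxLinks d m) :
    |(∫ U, F U ∂(ymSpecification (d := d) (fundamentalRep (Fin N)) (N * β) (boxLinks d n) η)) - ∫ U, F U ∂μ| ≤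
      2 * Real.sqrt N * KF * Δ.card * (max ρ (1 / 2)) ^ (n - m) := by
  have key := suN_wilson_boundary_bakryEmery hd hN hb hρ hρ1 hμ (boxLinks d n) η hF (D := (n : ℝ) - m)
    fun _ hy _ hz => sub_le_norm_sub_of_mem_boxLinks (hΔ hy) hz
  rwa [natFloor_natCast_sub_natCast] at key

/-- ★ **FINITE-SIZE EFFECT OF THE TORUS, EVERY `N ≥ 2`, EVERY `d ≥ 1`** (Bakry–Émery window `2(d−1)|β| < 1/2` with
`6(d−1)|β|/(1/2 − 2(d−1)|β|) ≤ ρ < 1`): for every DLR state `μ`, every torus side `L > 2(n+1)`, `m ≤ n`, and every Lipschitz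
cylinder on links based in `[−m, m]^d`: `|⟨F ∘ torusLift⟩_{(ℤ/L)^d, Nβ} − ∫ F dμ| ≤ 2√N · K_F · #Δ · max(ρ,½)^{n − m}`. [folklore] -/
theorem suN_wilson_torus_bakryEmery (hd : 1 ≤ d) (hN : 2 ≤ N) {β ρ : ℝ} (hb : |β| * (2 * ((d : ℝ) - 1)) < 1 / 2)
    (hρ : 6 * ((d : ℝ) - 1) * |β| / (1 / 2 - |β| * (2 * ((d : ℝ) - 1))) ≤ ρ) (hρ1 : ρ < 1)
    {μ : Measure (LGConfig d (Matrix.specialUnitaryGroup (Fin N) ℂ))}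
    (hμ : μ ∈ ymGibbsMeasures (d := d) (fundamentalRep (Fin N)) (N * β)) {m n L : ℕ} [NeZero L] (hmn : m ≤ n)
    (hL : 2 * (n + 1) < L) {F : LGConfig d (Matrix.specialUnitaryGroup (Fin N) ℂ) → ℝ} {Δ : Finset (ZdEdge d)}
    {KF : ℝ≥0} (hF : IsLipschitzCylinder (fundamentalRep (Fin N)) F Δ KF) (hΔ : Δ ⊆ boxLinks d m) :
    |wilsonExpectation (fundamentalRep (Fin N)) (N * β) (toTorusObservable L F) - ∫ U, F U ∂μ| ≤
      2 * Real.sqrt N * KF * Δ.card * (max ρ (1 / 2)) ^ (n - m) :=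
  abs_wilsonExpectation_sub_le_of_forall_boundary (fundamentalRep (Fin N)) (continuous_fundamentalRep (Fin N)) (N * β)
    (boxLinks d n) (continuous_of_isLipschitzCylinder hF) hF.abs_le hF.isCylinder
    ((injOn_proj_siteBox hL).mono (Finset.coe_subset.2 (image_fst_boxCollar_subset hmn hΔ)))
    fun η => suN_wilson_box_bakryEmery hd hN hb hρ hρ1 hμ n η hF hΔ

end Summit.Ventures.YMGap.RobustBall

end
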